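import Literature.Computability.Complexity.MCSPStarFromRedOut
import Literature.Computability.Complexity.HiraharaCoins
import Literature.Computability.Complexity.HiraharaMachine
import HarnessLib

/-!
# Hirahara's randomized reduction from `gapCMMSA` to `MCSP*`: the discharge

Topic `Computability/Complexity`. The named fact `Hirahara2022_gapCMMSA_randReducible_MCSPStar`
(`MCSPHardnessProofs.lean`; Hirahara, ECCC TR22-119, Thm. 8.5 for `MCSP*` with Lemma 8.3: for every
`α > 0`, `gapCMMSA (Δ^α) (Δ^{-α}) sqrtLog` reduces to `MCSP*` by a randomized polynomial-time
many-one reduction) is PROVED: the reduction `HiraharaRed.redOut` (`HiraharaSpec.lean`) is correct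
on the promise and assembles into the randomized reduction given an implementation
(`MCSPStarFromRedOut.lean`: `Hirahara2022_gapCMMSA_randReducible_MCSPStar_of_pairFn`, with the
coin budget of `HiraharaCoins.lean`), and the implementation — a polynomial-time string function
computing `redOut c` on the code `⟨code I₀, r⟩` for every `c ≥ 1` — is
`HiraharaMachine.redOut_codeFP` (`HiraharaMachine.lean`, parts I–VII).

## References

* S. Hirahara, *NP-hardness of learning programs and partial MCSP*, ECCC TR22-119 (FOCS 2022),
  Thm. 8.5 and its proof (p. 31), Lemma 8.3, Lemma 8.1, Prop. 6.2, Lemma 4.5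
  [Hirahara2022PartialMCSP].
-/

namespace Literature.Computability.Complexity

/-- **Hirahara 2022, Thm. 8.5 (`MCSP*` case): `gapCMMSA (Δ^α) (Δ^{-α}) sqrtLog` randomly reduces to
`MCSP*` in polynomial time, for every `α > 0`.** [cite: Hirahara2022PartialMCSP, Thm. 8.5 and its proof (MCSP* case, p. 31) with Lemma 8.3] -/
theorem Hirahara2022_gapCMMSA_randReducible_MCSPStar_holds : Hirahara2022_gapCMMSA_randReducible_MCSPStar :=
  HiraharaRed.Hirahara2022_gapCMMSA_randReducible_MCSPStar_of_pairFn fun c hc => by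
    obtain ⟨F, hF, hFeq⟩ := HiraharaMachine.redOut_codeFP c hc
    exact ⟨F, hF, HiraharaRed.coinPoly, fun I₀ r _ => hFeq (I₀, r),
      fun I₀ hwf => HiraharaRed.totCoins_toPInst_le_eval I₀ hwf⟩

end Literature.Computability.Complexity
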